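import Literature.NumberTheory.PAdicHodge.AinfRamifiedTransportedPeriodHom
import Literature.NumberTheory.PAdicHodge.BmaxPlusLogSumThetaValue
import Literature.NumberTheory.PAdicHodge.AinfWeierstrassSupersingularSmallPoints
import Literature.NumberTheory.PAdicHodge.BmaxPlusFormalLogFrobeniusNondegenerate
import Literature.NumberTheory.PAdicHodge.AinfWeierstrassRamifiedTorsionWitnessLe
import HarnessLib

/-!
# NON-DEGENERACY of the transported crystalline pair `(P⁰, φP⁰)` on `T_pŴ_D`: `θ(f P⁰τ) ≠ 0` or `θ(f φP⁰τ) ≠ 0` for some `τ`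

Topic `Literature/NumberTheory/PAdicHodge`; namespace `Literature.NumberTheory.PAdicHodge.AinfRamTop`. THEOREMS ONLY
(no definition, no named fact, no instance, no `sorry`). Setting of `AinfRamifiedTransportedPeriodHom`: `D` an Eisenstein datum (`𝒪_D = ℤ_p[ϖ]`,
`‖ϖ‖^e = ‖p‖`), `W = W_D` over `𝒪_D` read on `𝒪_F` through `ψ`, `E₀/ℤ` with `W_D ≡ E₀ (mod ϖ)`, the CM-fibre transport `T` (the exact `[p]_{E₀}`-tower
`‖ϖ‖`-close to a `[p]_{W_D}`-tower), `P⁰ : T_pŴ_D(𝒪_{ℂ_F}) →+ A_max` the transported period map (`P⁰τ = Λ_e(ι[T̃τ], z)`, hypothesis `hP0` = the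
characterisation proved in `exists_transportedPeriodHom`), `f = bmaxPlusToBdR`, `θ = thetaBdR`.

* §1 `thetaBdR_bmaxPlusToBdR_transportedPeriod_eq` — **`θ(f P⁰τ) = p^e · log_{E₀}((Tτ)₀)`** (T2a at `[T̃τ]`, depth `e`).
* §2 `thetaBdR_bmaxPlusToBdR_transportedPeriod_ne_zero` — case (a): if `(Tτ)₀ ≠ 0` and `e < p² − 1` then **`θ(f P⁰τ) ≠ 0`**: `‖(Tτ)₀‖ ≤ ‖ϖ‖`, so
  `‖(Tτ)₀‖^{p²−1} < ‖ϖ‖^e = ‖p‖` and a nonzero zero of `log_{E₀}` cannot be that small (`eq_zero_of_tsum_formalLog_eq_zero_of_norm_pow_lt`, supersingular `E₀`).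
* §3 case (b), `(Tτ)₀ = 0` (`Tτ ∈ T_pÊ₀`): `transportedPeriod_eq_pow_mul_logSum_one` (**`P⁰τ = p^{e−1}·Λ_1(ι[T̃τ], z₁)`**, change of depth),
  `thetaBdR_bmaxPlusToBdR_frobBmaxPlus_transportedPeriod_eq` (`θ(f φP⁰τ) = p^{e−1}·θ(f φΛ_1)`), and
  `thetaBdR_bmaxPlusToBdR_frobBmaxPlus_transportedPeriod_ne_zero`: if moreover `(Tτ)₁ ≠ 0` then **`θ(f φP⁰τ) ≠ 0`** — the φ-road's
  `thetaBmaxPlus_frobBmaxPlus_logSum_ne_zero` for `E₀` at the Tate-module point `Tτ` (`‖p‖ ≤ ‖(Tτ)₁‖^{p²−1} < ‖(Tτ)₁‖`).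
* §4 ★★★ `exists_thetaBdR_transportedPeriod_ne_zero_or` — **the DICHOTOMY: `(∃ τ, θ(f P⁰τ) ≠ 0) ∨ (∃ τ, θ(f φP⁰τ) ≠ 0)`** (`p ≥ 5`, `e < p² − 1`, `E₀` good
  supersingular, `W_D ⊗_ψ 𝒪_F` good supersingular of exact height `2`): at the `τ` of `AinfWeierstrassRamifiedTorsionWitnessLe` (`‖p‖ ≤ ‖τ₁‖^{p²−1}`), `‖τ₁‖ > ‖ϖ‖` so `(Tτ)₁ ≠ 0`; then §2 or §3 according as `(Tτ)₀ ≠ 0`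
  or `= 0`. This is the socket hypothesis `hnot` for `Pη ∈ {f∘P⁰, f∘φ∘P⁰}` of the transported pair.

Purpose (crux K★ `stmt-BirchSwinnertonDyer-22226`, line `kato_lever`, memo `Lines/kato-lever-K2-ramified-cm-transport.md` §10.1, «hne/hnot»): the one design
point left for (K₂) at the K★ cells — non-degeneracy of `(Pω″, Pη)` — reduced to kernel theorems; the Hodge scalars `A, B` and the choice of `Pη` are the
caller's (if `θ(f P⁰τ) ≠ 0` somewhere take `Pη = f∘P⁰`, else `Pη = f∘φ∘P⁰`). Infrastructure only; BSD / K★ are not proved by any of this.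

## References
* P. Colmez, *Périodes p-adiques des variétés abéliennes*, Math. Ann. 292 (1992), §2. [Colmez1992PeriodesAbeliennes]
* J. Tate, *p-divisible groups* (1967), §4. [Tate1967]
* J.-P. Serre, *Propriétés galoisiennes des points d'ordre fini des courbes elliptiques*, Invent. Math. 15 (1972), §1.11. [Serre1972]
* J.-M. Fontaine, *Le corps des périodes p-adiques*, Astérisque 223 (1994), Exp. III Prop. 5.1.3. [FontaineAsterisque223III]
* J. H. Silverman, *The Arithmetic of Elliptic Curves* (2009), IV.6.4, IV.7, VII.2.2. [SilvermanAEC2009]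
-/

noncomputable section

open scoped Classical NNReal
open PowerSeries Filter Topology Field WittVector ValuativeRel Polynomial

namespace Literature.NumberTheory.PAdicHodge

/-! ## §1 `θ(f P⁰τ) = p^e · log_{E₀}((Tτ)₀)` -/

namespace AinfRamTop

open Literature.NumberTheory.GaloisRepresentations Literature.NumberTheory.GaloisRepresentations.IsNonarchimedeanLocalField
open Literature.NumberTheory.GaloisRepresentations.LubinTate Literature.NumberTheory.EllipticCurves
open Literature.RingTheory.FormalGroups Literature.AlgebraicGeometry.Resolution GaloisContinuity

variable {F : Type} [Field F] [ValuativeRel F] [TopologicalSpace F] [IsNonarchimedeanLocalField F] [CharZero F]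
  {p : ℕ} [hpp : Fact p.Prime] {hp : valuation F p < 1} (D : EisensteinRoot F p hp)
  [Fact (¬ IsUnit (p : integerC F))] [IsAdicComplete (Ideal.span {(p : integerC F)}) (integerC F)]
  {hθ : Function.Surjective (fontaineTheta (integerC F) p)}

set_option maxHeartbeats 1600000 in
/-- ★ **`θ_dR(f(P⁰τ)) = p^e · Σ'[Xʲ]log_{E₀}·(Tτ)₀ʲ`**: the θ-value of the transported period at `τ ∈ T_pŴ_D` is `p^e` times the value of `log_{E₀}` at the
bottom `(Tτ)₀` of ANY transport `Tτ` (exact `[p]_{E₀}`-tower `‖ϖ‖`-close to `seqO τ`; `‖(Tτ)₀‖^e ≤ ‖p‖` gives the depth-`e` witness).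
[cite: Colmez1992PeriodesAbeliennes, §2] [cite: FontaineAsterisque223III, Exp. III Prop. 5.1.3] -/
theorem thetaBdR_bmaxPlusToBdR_transportedPeriod_eq [CharZero (CompletedAlgClosure F)] (W : WeierstrassCurve (EisensteinRoot.CoeffDisc D))
    (E₀ : WeierstrassCurve ℤ) (ψ : EisensteinRoot.CoeffDisc D →+* LTCoeff F)
    (P0 : AinfTop.TatePtO F (W.map ψ) p →+ BmaxPlus F p)
    (hP0 : ∀ (τ : AinfTop.TatePtO F (W.map ψ) p) (w : ℕ → (maxNilIdealC F).toIdeal) (hw : ∀ n, AinfTop.mulPC F p E₀ (w (n + 1)) = w n),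
        (∀ n, ‖(((w n : (maxNilIdealC F).toIdeal) : CBall F) : CompletedAlgClosure F) -
          (((AinfTop.seqO (W.map ψ) τ n : (maxNilIdealC F).toIdeal) : CBall F) : CompletedAlgClosure F)‖ ≤
            ‖((D.rootC : integerC F) : CompletedAlgClosure F)‖) →
        ∀ z : bmaxZero F p,
          algebraMap (Ainf (p := p) F) (bmaxZero F p) ((AinfTop.of F p).symm
              (((AinfTop.divisionLiftPt E₀ hθ w hw).val : (AinfTop.nilTheta F p hθ).toIdeal) : AinfTop F p)) ^ D.e = (p : bmaxZero F p) * z →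
          P0 τ = PadicLogSeries.logSum ((algebraMap (Ainf (p := p) F) (bmaxZero F p)).comp zpToAinf) (GaloisContinuity.formalLogNum E₀ p) D.e
            (algebraMap (Ainf (p := p) F) (bmaxZero F p) ((AinfTop.of F p).symm
              (((AinfTop.divisionLiftPt E₀ hθ w hw).val : (AinfTop.nilTheta F p hθ).toIdeal) : AinfTop F p))) z)
    (τ : AinfTop.TatePtO F (W.map ψ) p) {w : ℕ → (maxNilIdealC F).toIdeal} (hw : ∀ n, AinfTop.mulPC F p E₀ (w (n + 1)) = w n)
    (hwτ : ∀ n, ‖(((w n : (maxNilIdealC F).toIdeal) : CBall F) : CompletedAlgClosure F) -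
      (((AinfTop.seqO (W.map ψ) τ n : (maxNilIdealC F).toIdeal) : CBall F) : CompletedAlgClosure F)‖ ≤
        ‖((D.rootC : integerC F) : CompletedAlgClosure F)‖) :
    thetaBdR (bmaxPlusToBdR F p (P0 τ)) =
      (p : CompletedAlgClosure F) ^ D.e *
        ∑' j : ℕ, PowerSeries.coeff j (E₀.map (Int.castRingHom (CompletedAlgClosure F))).formalLog *
          (((w 0 : (maxNilIdealC F).toIdeal) : CBall F) : CompletedAlgClosure F) ^ j := by
  have hdepth : ‖(((w 0 : (maxNilIdealC F).toIdeal) : CBall F) : CompletedAlgClosure F)‖ ^ D.e ≤ ‖(p : CompletedAlgClosure F)‖ :=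
    norm_transport_zero_pow_le D (AinfTop.seqO_zero (W.map ψ) τ) hwτ
  have hmem := AinfTop.pow_coe_val_nsmul_divisionLiftPt_mem E₀ (hθ := hθ) hw hdepth 1
  rw [one_nsmul] at hmem
  obtain ⟨z, hz⟩ := exists_algebraMap_pow_eq_natCast_mul hmem
  rw [hP0 τ w hw hwτ z hz]
  exact AinfTop.thetaBdR_bmaxPlusToBdR_logSum_torsionLift_eq_pow_mul_tsum E₀ (hθ := hθ) hp D.e_pos hw hz

/-! ## §2 Case (a): `(Tτ)₀ ≠ 0 ⇒ θ(f P⁰τ) ≠ 0` -/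

omit hpp [Fact (¬ IsUnit (p : integerC F))] [IsAdicComplete (Ideal.span {(p : integerC F)}) (integerC F)] in
/-- `‖ϖ‖ > 0`. [cite: SerreLocalFields1979, Ch. I §6 Prop. 17] -/
private theorem norm_rootC_pos [CharZero (CompletedAlgClosure F)] [hpp : Fact p.Prime] (D : EisensteinRoot F p hp) :
    0 < ‖((D.rootC : integerC F) : CompletedAlgClosure F)‖ := by
  have hp0 : (p : CompletedAlgClosure F) ≠ 0 := Nat.cast_ne_zero.mpr hpp.out.ne_zero
  by_contra hle
  have h0 : ‖((D.rootC : integerC F) : CompletedAlgClosure F)‖ = 0 := le_antisymm (not_lt.mp hle) (norm_nonneg _)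
  have h := D.norm_rootC_pow
  rw [h0, zero_pow D.e_pos.ne'] at h
  exact hp0 (norm_eq_zero.mp h.symm)

omit hpp [Fact (¬ IsUnit (p : integerC F))] [IsAdicComplete (Ideal.span {(p : integerC F)}) (integerC F)] in
/-- **`‖x‖ ≤ ‖ϖ‖` and `e < p² − 1` give `‖x‖^{p²−1} < ‖p‖`** (`‖ϖ‖^{p²−1} < ‖ϖ‖^e = ‖p‖`). [cite: SerreLocalFields1979, Ch. I §6 Prop. 17] -/
theorem norm_pow_lt_norm_p_of_norm_le_rootC [CharZero (CompletedAlgClosure F)] [hpp : Fact p.Prime] (D : EisensteinRoot F p hp)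
    (he : D.e < p ^ 2 - 1) {x : CompletedAlgClosure F} (hx : ‖x‖ ≤ ‖((D.rootC : integerC F) : CompletedAlgClosure F)‖) :
    ‖x‖ ^ (p ^ 2 - 1) < ‖(p : CompletedAlgClosure F)‖ :=
  calc ‖x‖ ^ (p ^ 2 - 1) ≤ ‖((D.rootC : integerC F) : CompletedAlgClosure F)‖ ^ (p ^ 2 - 1) := pow_le_pow_left₀ (norm_nonneg _) hx _
    _ < ‖((D.rootC : integerC F) : CompletedAlgClosure F)‖ ^ D.e := pow_lt_pow_right_of_lt_one₀ (norm_rootC_pos D) D.norm_rootC_lt_one he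
    _ = ‖(p : CompletedAlgClosure F)‖ := D.norm_rootC_pow

set_option maxHeartbeats 1600000 in
/-- ★★ **Case (a): `(Tτ)₀ ≠ 0 ⇒ θ_dR(f(P⁰τ)) ≠ 0`** when `e < p² − 1` and `E₀` has good supersingular reduction (`p` odd): `θ(f P⁰τ) = p^e·log_{E₀}((Tτ)₀)` and a
NON-ZERO zero `x` of `log_{E₀}` has `‖x‖^{p²−1} ≥ ‖p‖`, while `‖(Tτ)₀‖ ≤ ‖ϖ‖` forces `‖(Tτ)₀‖^{p²−1} < ‖p‖`. [cite: Tate1967, §4] [cite: SilvermanAEC2009, Thm. IV.6.4] -/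
theorem thetaBdR_bmaxPlusToBdR_transportedPeriod_ne_zero [CharZero (CompletedAlgClosure F)] (W : WeierstrassCurve (EisensteinRoot.CoeffDisc D))
    (E₀ : WeierstrassCurve ℤ) [(curveOver (CompletedAlgClosure F) E₀).IsElliptic] (hp2 : p ≠ 2)
    (hA₀ : (E₀.map (Int.castRingHom (ZMod p))).hasseCoeff p = 0) (he : D.e < p ^ 2 - 1) (ψ : EisensteinRoot.CoeffDisc D →+* LTCoeff F)
    (P0 : AinfTop.TatePtO F (W.map ψ) p →+ BmaxPlus F p)
    (hP0 : ∀ (τ : AinfTop.TatePtO F (W.map ψ) p) (w : ℕ → (maxNilIdealC F).toIdeal) (hw : ∀ n, AinfTop.mulPC F p E₀ (w (n + 1)) = w n),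
        (∀ n, ‖(((w n : (maxNilIdealC F).toIdeal) : CBall F) : CompletedAlgClosure F) -
          (((AinfTop.seqO (W.map ψ) τ n : (maxNilIdealC F).toIdeal) : CBall F) : CompletedAlgClosure F)‖ ≤
            ‖((D.rootC : integerC F) : CompletedAlgClosure F)‖) →
        ∀ z : bmaxZero F p,
          algebraMap (Ainf (p := p) F) (bmaxZero F p) ((AinfTop.of F p).symm
              (((AinfTop.divisionLiftPt E₀ hθ w hw).val : (AinfTop.nilTheta F p hθ).toIdeal) : AinfTop F p)) ^ D.e = (p : bmaxZero F p) * z →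
          P0 τ = PadicLogSeries.logSum ((algebraMap (Ainf (p := p) F) (bmaxZero F p)).comp zpToAinf) (GaloisContinuity.formalLogNum E₀ p) D.e
            (algebraMap (Ainf (p := p) F) (bmaxZero F p) ((AinfTop.of F p).symm
              (((AinfTop.divisionLiftPt E₀ hθ w hw).val : (AinfTop.nilTheta F p hθ).toIdeal) : AinfTop F p))) z)
    (τ : AinfTop.TatePtO F (W.map ψ) p) {w : ℕ → (maxNilIdealC F).toIdeal} (hw : ∀ n, AinfTop.mulPC F p E₀ (w (n + 1)) = w n)
    (hwτ : ∀ n, ‖(((w n : (maxNilIdealC F).toIdeal) : CBall F) : CompletedAlgClosure F) -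
      (((AinfTop.seqO (W.map ψ) τ n : (maxNilIdealC F).toIdeal) : CBall F) : CompletedAlgClosure F)‖ ≤
        ‖((D.rootC : integerC F) : CompletedAlgClosure F)‖)
    (hw0 : (((w 0 : (maxNilIdealC F).toIdeal) : CBall F) : CompletedAlgClosure F) ≠ 0) :
    thetaBdR (bmaxPlusToBdR F p (P0 τ)) ≠ 0 := by
  have hp0 : (p : CompletedAlgClosure F) ≠ 0 := Nat.cast_ne_zero.mpr hpp.out.ne_zero
  rw [thetaBdR_bmaxPlusToBdR_transportedPeriod_eq D W E₀ ψ P0 hP0 τ hw hwτ]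
  refine mul_ne_zero (pow_ne_zero _ hp0) fun hlog => hw0 ?_
  exact AinfTop.eq_zero_of_tsum_formalLog_eq_zero_of_norm_pow_lt E₀ hp2 hA₀ hlog
    (norm_pow_lt_norm_p_of_norm_le_rootC D he (norm_transport_zero_le D (AinfTop.seqO_zero (W.map ψ) τ) hwτ))

/-! ## §3 Case (b): `(Tτ)₀ = 0` — change of depth and the φ-partner -/

set_option maxHeartbeats 1600000 in
/-- ★ **Change of depth for a TORSION transport: `P⁰τ = p^{e−1} · Λ_1(ι[T̃τ], z₁)`** when `(Tτ)₀ = 0` (then `[T̃τ] ∈ ker θ` and a depth-`1` witness `z₁` exists;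
`Λ_e = p^{e−1}Λ_1`, `PadicLogSeries.logSum_eq_pow_mul_logSum`). [cite: Colmez1992PeriodesAbeliennes, §2] -/
theorem transportedPeriod_eq_pow_mul_logSum_one (W : WeierstrassCurve (EisensteinRoot.CoeffDisc D)) (E₀ : WeierstrassCurve ℤ)
    (ψ : EisensteinRoot.CoeffDisc D →+* LTCoeff F) (P0 : AinfTop.TatePtO F (W.map ψ) p →+ BmaxPlus F p)
    (hP0 : ∀ (τ : AinfTop.TatePtO F (W.map ψ) p) (w : ℕ → (maxNilIdealC F).toIdeal) (hw : ∀ n, AinfTop.mulPC F p E₀ (w (n + 1)) = w n),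
        (∀ n, ‖(((w n : (maxNilIdealC F).toIdeal) : CBall F) : CompletedAlgClosure F) -
          (((AinfTop.seqO (W.map ψ) τ n : (maxNilIdealC F).toIdeal) : CBall F) : CompletedAlgClosure F)‖ ≤
            ‖((D.rootC : integerC F) : CompletedAlgClosure F)‖) →
        ∀ z : bmaxZero F p,
          algebraMap (Ainf (p := p) F) (bmaxZero F p) ((AinfTop.of F p).symm
              (((AinfTop.divisionLiftPt E₀ hθ w hw).val : (AinfTop.nilTheta F p hθ).toIdeal) : AinfTop F p)) ^ D.e = (p : bmaxZero F p) * z →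
          P0 τ = PadicLogSeries.logSum ((algebraMap (Ainf (p := p) F) (bmaxZero F p)).comp zpToAinf) (GaloisContinuity.formalLogNum E₀ p) D.e
            (algebraMap (Ainf (p := p) F) (bmaxZero F p) ((AinfTop.of F p).symm
              (((AinfTop.divisionLiftPt E₀ hθ w hw).val : (AinfTop.nilTheta F p hθ).toIdeal) : AinfTop F p))) z)
    (τ : AinfTop.TatePtO F (W.map ψ) p) {w : ℕ → (maxNilIdealC F).toIdeal} (hw : ∀ n, AinfTop.mulPC F p E₀ (w (n + 1)) = w n)
    (hwτ : ∀ n, ‖(((w n : (maxNilIdealC F).toIdeal) : CBall F) : CompletedAlgClosure F) -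
      (((AinfTop.seqO (W.map ψ) τ n : (maxNilIdealC F).toIdeal) : CBall F) : CompletedAlgClosure F)‖ ≤
        ‖((D.rootC : integerC F) : CompletedAlgClosure F)‖)
    {z₁ : bmaxZero F p}
    (hz₁ : algebraMap (Ainf (p := p) F) (bmaxZero F p) ((AinfTop.of F p).symm
      (((AinfTop.divisionLiftPt E₀ hθ w hw).val : (AinfTop.nilTheta F p hθ).toIdeal) : AinfTop F p)) ^ 1 = (p : bmaxZero F p) * z₁) :
    P0 τ = AdicCompletion.of (Ideal.span {(p : bmaxZero F p)}) (bmaxZero F p) ((p : bmaxZero F p) ^ (D.e - 1)) *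
      PadicLogSeries.logSum ((algebraMap (Ainf (p := p) F) (bmaxZero F p)).comp zpToAinf) (GaloisContinuity.formalLogNum E₀ p) 1
        (algebraMap (Ainf (p := p) F) (bmaxZero F p) ((AinfTop.of F p).symm
          (((AinfTop.divisionLiftPt E₀ hθ w hw).val : (AinfTop.nilTheta F p hθ).toIdeal) : AinfTop F p))) z₁ := by
  haveI := isDomain_bmaxZero (F := F) (p := p)
  haveI := charZero_bmaxZero (F := F) (p := p)
  have hdepth : ‖(((w 0 : (maxNilIdealC F).toIdeal) : CBall F) : CompletedAlgClosure F)‖ ^ D.e ≤ ‖(p : CompletedAlgClosure F)‖ :=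
    norm_transport_zero_pow_le D (AinfTop.seqO_zero (W.map ψ) τ) hwτ
  have hmem := AinfTop.pow_coe_val_nsmul_divisionLiftPt_mem E₀ (hθ := hθ) hw hdepth 1
  rw [one_nsmul] at hmem
  obtain ⟨z, hz⟩ := exists_algebraMap_pow_eq_natCast_mul hmem
  rw [hP0 τ w hw hwτ z hz]
  exact PadicLogSeries.logSum_eq_pow_mul_logSum _ _ le_rfl D.e_pos hz₁ hz

set_option maxHeartbeats 1600000 in
/-- ★ **`θ_dR(f(φ P⁰τ)) = p^{e−1} · θ_dR(f(φ Λ_1(ι[T̃τ], z₁)))`** for a torsion transport (`(Tτ)₀ = 0`). [cite: Colmez1992PeriodesAbeliennes, §2] -/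
theorem thetaBdR_bmaxPlusToBdR_frobBmaxPlus_transportedPeriod_eq (W : WeierstrassCurve (EisensteinRoot.CoeffDisc D)) (E₀ : WeierstrassCurve ℤ)
    (ψ : EisensteinRoot.CoeffDisc D →+* LTCoeff F) (P0 : AinfTop.TatePtO F (W.map ψ) p →+ BmaxPlus F p)
    (hP0 : ∀ (τ : AinfTop.TatePtO F (W.map ψ) p) (w : ℕ → (maxNilIdealC F).toIdeal) (hw : ∀ n, AinfTop.mulPC F p E₀ (w (n + 1)) = w n),
        (∀ n, ‖(((w n : (maxNilIdealC F).toIdeal) : CBall F) : CompletedAlgClosure F) -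
          (((AinfTop.seqO (W.map ψ) τ n : (maxNilIdealC F).toIdeal) : CBall F) : CompletedAlgClosure F)‖ ≤
            ‖((D.rootC : integerC F) : CompletedAlgClosure F)‖) →
        ∀ z : bmaxZero F p,
          algebraMap (Ainf (p := p) F) (bmaxZero F p) ((AinfTop.of F p).symm
              (((AinfTop.divisionLiftPt E₀ hθ w hw).val : (AinfTop.nilTheta F p hθ).toIdeal) : AinfTop F p)) ^ D.e = (p : bmaxZero F p) * z →
          P0 τ = PadicLogSeries.logSum ((algebraMap (Ainf (p := p) F) (bmaxZero F p)).comp zpToAinf) (GaloisContinuity.formalLogNum E₀ p) D.e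
            (algebraMap (Ainf (p := p) F) (bmaxZero F p) ((AinfTop.of F p).symm
              (((AinfTop.divisionLiftPt E₀ hθ w hw).val : (AinfTop.nilTheta F p hθ).toIdeal) : AinfTop F p))) z)
    (τ : AinfTop.TatePtO F (W.map ψ) p) {w : ℕ → (maxNilIdealC F).toIdeal} (hw : ∀ n, AinfTop.mulPC F p E₀ (w (n + 1)) = w n)
    (hwτ : ∀ n, ‖(((w n : (maxNilIdealC F).toIdeal) : CBall F) : CompletedAlgClosure F) -
      (((AinfTop.seqO (W.map ψ) τ n : (maxNilIdealC F).toIdeal) : CBall F) : CompletedAlgClosure F)‖ ≤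
        ‖((D.rootC : integerC F) : CompletedAlgClosure F)‖)
    {z₁ : bmaxZero F p}
    (hz₁ : algebraMap (Ainf (p := p) F) (bmaxZero F p) ((AinfTop.of F p).symm
      (((AinfTop.divisionLiftPt E₀ hθ w hw).val : (AinfTop.nilTheta F p hθ).toIdeal) : AinfTop F p)) ^ 1 = (p : bmaxZero F p) * z₁) :
    thetaBdR (bmaxPlusToBdR F p (frobBmaxPlus F p (P0 τ))) =
      (p : CompletedAlgClosure F) ^ (D.e - 1) *
        thetaBdR (bmaxPlusToBdR F p (frobBmaxPlus F p
          (PadicLogSeries.logSum ((algebraMap (Ainf (p := p) F) (bmaxZero F p)).comp zpToAinf) (GaloisContinuity.formalLogNum E₀ p) 1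
            (algebraMap (Ainf (p := p) F) (bmaxZero F p) ((AinfTop.of F p).symm
              (((AinfTop.divisionLiftPt E₀ hθ w hw).val : (AinfTop.nilTheta F p hθ).toIdeal) : AinfTop F p))) z₁))) := by
  have hofpow : AdicCompletion.of (Ideal.span {(p : bmaxZero F p)}) (bmaxZero F p) ((p : bmaxZero F p) ^ (D.e - 1)) =
      (p : BmaxPlus F p) ^ (D.e - 1) := by
    change algebraMap (bmaxZero F p) (BmaxPlus F p) ((p : bmaxZero F p) ^ (D.e - 1)) = _
    rw [map_pow, map_natCast]
  rw [transportedPeriod_eq_pow_mul_logSum_one D W E₀ ψ P0 hP0 τ hw hwτ hz₁, hofpow]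
  simp only [map_mul, map_pow, map_natCast]

set_option maxHeartbeats 1600000 in
/-- ★★ **Case (b): `(Tτ)₀ = 0`, `(Tτ)₁ ≠ 0 ⇒ θ_dR(f(φ P⁰τ)) ≠ 0`** for `E₀/ℤ` with good supersingular reduction at `p ≥ 5` (`E₀ ⊗ ℚ_p`, `E₀ ⊗ 𝔽_p` elliptic):
`θ(f φP⁰τ) = p^{e−1}·θ(f φΛ_1(ι[T̃τ], z₁))` and `θ_max(φΛ_1) ≠ 0` by the φ-road's `thetaBmaxPlus_frobBmaxPlus_logSum_ne_zero` at the Tate-module point `Tτ`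
of `Ê₀` (`‖p‖ ≤ ‖(Tτ)₁‖^{p²−1} < ‖(Tτ)₁‖`, non-zero `p`-torsion of a supersingular `Ê₀`). [cite: Tate1967, §4] [cite: FontaineAsterisque223III, Exp. III Prop. 5.1.3] -/
theorem thetaBdR_bmaxPlusToBdR_frobBmaxPlus_transportedPeriod_ne_zero [CharZero (CompletedAlgClosure F)]
    (W : WeierstrassCurve (EisensteinRoot.CoeffDisc D)) (E₀ : WeierstrassCurve ℤ)
    [(E₀.map (Int.castRingHom ℚ_[p])).IsElliptic] [(E₀.map (Int.castRingHom (ZMod p))).IsElliptic] (hp5 : 5 ≤ p) (hΔ₀ : ¬ (p : ℤ) ∣ E₀.Δ)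
    (hA₀ : (E₀.map (Int.castRingHom (ZMod p))).hasseCoeff p = 0) (ψ : EisensteinRoot.CoeffDisc D →+* LTCoeff F)
    (P0 : AinfTop.TatePtO F (W.map ψ) p →+ BmaxPlus F p)
    (hP0 : ∀ (τ : AinfTop.TatePtO F (W.map ψ) p) (w : ℕ → (maxNilIdealC F).toIdeal) (hw : ∀ n, AinfTop.mulPC F p E₀ (w (n + 1)) = w n),
        (∀ n, ‖(((w n : (maxNilIdealC F).toIdeal) : CBall F) : CompletedAlgClosure F) -
          (((AinfTop.seqO (W.map ψ) τ n : (maxNilIdealC F).toIdeal) : CBall F) : CompletedAlgClosure F)‖ ≤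
            ‖((D.rootC : integerC F) : CompletedAlgClosure F)‖) →
        ∀ z : bmaxZero F p,
          algebraMap (Ainf (p := p) F) (bmaxZero F p) ((AinfTop.of F p).symm
              (((AinfTop.divisionLiftPt E₀ hθ w hw).val : (AinfTop.nilTheta F p hθ).toIdeal) : AinfTop F p)) ^ D.e = (p : bmaxZero F p) * z →
          P0 τ = PadicLogSeries.logSum ((algebraMap (Ainf (p := p) F) (bmaxZero F p)).comp zpToAinf) (GaloisContinuity.formalLogNum E₀ p) D.e
            (algebraMap (Ainf (p := p) F) (bmaxZero F p) ((AinfTop.of F p).symm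
              (((AinfTop.divisionLiftPt E₀ hθ w hw).val : (AinfTop.nilTheta F p hθ).toIdeal) : AinfTop F p))) z)
    (τ : AinfTop.TatePtO F (W.map ψ) p) {w : ℕ → (maxNilIdealC F).toIdeal} (hw : ∀ n, AinfTop.mulPC F p E₀ (w (n + 1)) = w n)
    (hwτ : ∀ n, ‖(((w n : (maxNilIdealC F).toIdeal) : CBall F) : CompletedAlgClosure F) -
      (((AinfTop.seqO (W.map ψ) τ n : (maxNilIdealC F).toIdeal) : CBall F) : CompletedAlgClosure F)‖ ≤
        ‖((D.rootC : integerC F) : CompletedAlgClosure F)‖)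
    (hw0 : ((w 0 : (maxNilIdealC F).toIdeal) : CBall F) = 0) (hw1 : (((w 1 : (maxNilIdealC F).toIdeal) : CBall F) : CompletedAlgClosure F) ≠ 0) :
    thetaBdR (bmaxPlusToBdR F p (frobBmaxPlus F p (P0 τ))) ≠ 0 := by
  have hprime : p.Prime := hpp.out
  have hp2 : p ≠ 2 := by omega
  have hp0 : (p : CompletedAlgClosure F) ≠ 0 := Nat.cast_ne_zero.mpr hprime.ne_zero
  -- a depth-`1` witness for the torsion tower `w = Tτ`
  have hw0' : (((w 0 : (maxNilIdealC F).toIdeal) : CBall F) : CompletedAlgClosure F) = 0 := by rw [hw0]; rfl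
  have hN1 : ‖(((w 0 : (maxNilIdealC F).toIdeal) : CBall F) : CompletedAlgClosure F)‖ ^ 1 ≤ ‖(p : CompletedAlgClosure F)‖ := by
    rw [hw0', norm_zero, pow_one]; exact norm_nonneg _
  have hmem := AinfTop.pow_coe_val_nsmul_divisionLiftPt_mem E₀ (hθ := hθ) hw hN1 1
  rw [one_nsmul] at hmem
  obtain ⟨z₁, hz₁⟩ := exists_algebraMap_pow_eq_natCast_mul hmem
  rw [thetaBdR_bmaxPlusToBdR_frobBmaxPlus_transportedPeriod_eq D W E₀ ψ P0 hP0 τ hw hwτ hz₁, thetaBdR_bmaxPlusToBdR]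
  refine mul_ne_zero (pow_ne_zero _ hp0) ?_
  -- the φ-road's non-degeneracy at the Tate-module point `Tτ ∈ T_pÊ₀`
  obtain ⟨e, he⟩ := AinfTop.exists_natCast_mul_eq_honda_formalLogNum (p := p) E₀
  have hmul : (((AinfTop.mulPC F p E₀ (w 1) : (maxNilIdealC F).toIdeal) : CBall F)) = 0 := by
    have h := hw 0
    rw [zero_add] at h
    rw [h]; exact hw0
  have hle := AinfTop.norm_p_le_norm_pow_of_mulPC_eq_zero E₀ hp2 hA₀ (w 1) hw1 hmul
  have h₁ : ‖(p : CompletedAlgClosure F)‖ <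
      ‖(((AinfTop.seq E₀ (AinfTop.ofSeq E₀ w hw0 hw) 1 : (maxNilIdealC F).toIdeal) : CBall F) : CompletedAlgClosure F)‖ := by
    rw [AinfTop.seq_ofSeq]
    refine hle.trans_lt ?_
    have h1 : ‖(((w 1 : (maxNilIdealC F).toIdeal) : CBall F) : CompletedAlgClosure F)‖ < 1 := (w 1).2
    have hlt := pow_lt_pow_right_of_lt_one₀ (norm_pos_iff.mpr hw1) h1 (show 1 < p ^ 2 - 1 by
      have : 2 * 2 ≤ p * p := Nat.mul_le_mul (by omega) (by omega)
      rw [sq]; omega)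
    rwa [pow_one] at hlt
  have hne := AinfTop.thetaBmaxPlus_frobBmaxPlus_logSum_ne_zero E₀ (hθ := hθ) hp5 hΔ₀ hA₀ _ e he (AinfTop.ofSeq E₀ w hw0 hw) h₁ hz₁
  intro h0
  apply hne
  exact_mod_cast h0

/-! ## §4 The dichotomy -/

set_option maxHeartbeats 1600000 in
/-- ★★★ **NON-DEGENERACY DICHOTOMY for the transported pair: `(∃ τ, θ_dR(f(P⁰τ)) ≠ 0) ∨ (∃ τ, θ_dR(f(φP⁰τ)) ≠ 0)`** — for `p ≥ 5`, `e < p² − 1`, `E₀/ℤ` with good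
supersingular reduction (`E₀ ⊗ ℚ_p`, `E₀ ⊗ 𝔽_p`, `E₀ ⊗ ℂ_F` elliptic), and the ramified good model `W_D ⊗_ψ 𝒪_F` with `Δ ∈ 𝒪_Fˣ`, supersingular reduction of exact
height `2` and `W_D ≡ E₀ (mod ϖ)`. Proof: `AinfTop.exists_tatePtO_norm_p_le_norm_pow` gives `τ` with `‖p‖ ≤ ‖τ₁‖^{p²−1}`, so `‖τ₁‖ > ‖ϖ‖` and the transport has `(Tτ)₁ ≠ 0` (`‖(Tτ)₁ − τ₁‖ ≤ ‖ϖ‖`); if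
`(Tτ)₀ ≠ 0` use §2, else §3. (Socket `hnot` for `Pη = f∘P⁰`, resp. `f∘φ∘P⁰`.) [cite: Colmez1992PeriodesAbeliennes, §2] [cite: Tate1967, §4] [cite: Serre1972, §1.11] -/
theorem exists_thetaBdR_transportedPeriod_ne_zero_or [CharZero (CompletedAlgClosure F)] [CharP 𝓀[F] p]
    (W : WeierstrassCurve (EisensteinRoot.CoeffDisc D)) (E₀ : WeierstrassCurve ℤ) [(curveOver (CompletedAlgClosure F) E₀).IsElliptic]
    [(E₀.map (Int.castRingHom ℚ_[p])).IsElliptic] [(E₀.map (Int.castRingHom (ZMod p))).IsElliptic] (hp5 : 5 ≤ p) (hΔ₀ : ¬ (p : ℤ) ∣ E₀.Δ)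
    (hA₀ : (E₀.map (Int.castRingHom (ZMod p))).hasseCoeff p = 0) (he : D.e < p ^ 2 - 1)
    (hWE : W.map (Ideal.Quotient.mk (Ideal.span {EisensteinRoot.CoeffDisc.of D (AdjoinRoot.root D.poly)})) =
      (E₀.map (algebraMap ℤ (EisensteinRoot.CoeffDisc D))).map
        (Ideal.Quotient.mk (Ideal.span {EisensteinRoot.CoeffDisc.of D (AdjoinRoot.root D.poly)})))
    (ψ : EisensteinRoot.CoeffDisc D →+* LTCoeff F) (hψ : ∀ c, algebraMap (LTCoeff F) F (ψ c) = EisensteinRoot.CoeffDisc.toF D c)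
    (hΔ : IsUnit (W.map ψ).Δ) (hA : ((W.map ψ).map (AinfTop.redCoeff F)).hasseCoeff p = 0)
    (hht : PowerSeries.coeff (p ^ 2) (((W.map ψ).map (AinfTop.redCoeff F)).formalMul p) ≠ 0)
    (P0 : AinfTop.TatePtO F (W.map ψ) p →+ BmaxPlus F p)
    (hP0 : ∀ (τ : AinfTop.TatePtO F (W.map ψ) p) (w : ℕ → (maxNilIdealC F).toIdeal) (hw : ∀ n, AinfTop.mulPC F p E₀ (w (n + 1)) = w n),
        (∀ n, ‖(((w n : (maxNilIdealC F).toIdeal) : CBall F) : CompletedAlgClosure F) -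
          (((AinfTop.seqO (W.map ψ) τ n : (maxNilIdealC F).toIdeal) : CBall F) : CompletedAlgClosure F)‖ ≤
            ‖((D.rootC : integerC F) : CompletedAlgClosure F)‖) →
        ∀ z : bmaxZero F p,
          algebraMap (Ainf (p := p) F) (bmaxZero F p) ((AinfTop.of F p).symm
              (((AinfTop.divisionLiftPt E₀ hθ w hw).val : (AinfTop.nilTheta F p hθ).toIdeal) : AinfTop F p)) ^ D.e = (p : bmaxZero F p) * z →
          P0 τ = PadicLogSeries.logSum ((algebraMap (Ainf (p := p) F) (bmaxZero F p)).comp zpToAinf) (GaloisContinuity.formalLogNum E₀ p) D.e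
            (algebraMap (Ainf (p := p) F) (bmaxZero F p) ((AinfTop.of F p).symm
              (((AinfTop.divisionLiftPt E₀ hθ w hw).val : (AinfTop.nilTheta F p hθ).toIdeal) : AinfTop F p))) z) :
    (∃ τ : AinfTop.TatePtO F (W.map ψ) p, thetaBdR (bmaxPlusToBdR F p (P0 τ)) ≠ 0) ∨
      (∃ τ : AinfTop.TatePtO F (W.map ψ) p, thetaBdR (bmaxPlusToBdR F p (frobBmaxPlus F p (P0 τ))) ≠ 0) := by
  have hp2 : p ≠ 2 := by omega
  obtain ⟨τ, -, hτ⟩ := AinfTop.exists_tatePtO_norm_p_le_norm_pow (W.map ψ) hp2 hΔ hA hht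
  obtain ⟨w, ⟨hw, hwτ⟩, -⟩ := exists_unique_int_divisionSeq_of_ramified D W E₀ hWE (mulPC_seqO W ψ hψ τ)
  by_cases hw0 : (((w 0 : (maxNilIdealC F).toIdeal) : CBall F) : CompletedAlgClosure F) = 0
  · right
    have hw0' : ((w 0 : (maxNilIdealC F).toIdeal) : CBall F) = 0 := Subtype.ext (by rw [hw0]; rfl)
    -- `(Tτ)₁ ≠ 0`: `‖(Tτ)₁ − τ₁‖ ≤ ‖ϖ‖ < ‖τ₁‖`
    have hlt : ‖((D.rootC : integerC F) : CompletedAlgClosure F)‖ <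
        ‖(((AinfTop.seqO (W.map ψ) τ 1 : (maxNilIdealC F).toIdeal) : CBall F) : CompletedAlgClosure F)‖ := by
      rw [AinfTop.seqO_apply]
      exact lt_of_pow_lt_pow_left₀ _ (norm_nonneg _)
        ((pow_lt_pow_right_of_lt_one₀ (norm_rootC_pos D) D.norm_rootC_lt_one he).trans_le (D.norm_rootC_pow.trans_le hτ))
    have hw1 : (((w 1 : (maxNilIdealC F).toIdeal) : CBall F) : CompletedAlgClosure F) ≠ 0 := by
      intro hw1
      have hclose := hwτ 1
      rw [hw1, zero_sub, norm_neg] at hclose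
      exact absurd hclose (not_le.mpr hlt)
    exact ⟨τ, thetaBdR_bmaxPlusToBdR_frobBmaxPlus_transportedPeriod_ne_zero D W E₀ hp5 hΔ₀ hA₀ ψ P0 hP0 τ hw hwτ hw0' hw1⟩
  · left
    exact ⟨τ, thetaBdR_bmaxPlusToBdR_transportedPeriod_ne_zero D W E₀ hp2 hA₀ he ψ P0 hP0 τ hw hwτ hw0⟩

end AinfRamTop

end Literature.NumberTheory.PAdicHodge

end
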